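import Literature.MathematicalPhysics.QuantumFieldTheory.Balaban1983to89.B4Eq19LatticeOperators

/-!
# `Balaban1983to89.B4Eq19LatticeDirichletReplacement` — T. Bałaban, *Propagators and renormalization transformations for lattice gauge theories. II*,
# Commun. Math. Phys. **96** (1984) 223–250 [Balaban1984PropagatorsII] (1.9) p. 226: **THE DIRICHLET PROBLEM ON A BOX OF `ℤ^d` AND THE ENERGY BOUND OF THE
# HARMONIC REPLACEMENT** — for `κ > 0` and any box `Q_r(z)` every right side `ψ` has a unique `w` supported in `Q_r(z)` with `(−Δ+κ)w = ψ` on `Q_r(z)`; for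
# `ψ = ∂*g` its energy is `Σ|∇w|² ≤ Σ_{Q_{r+1}(z)} |g|²`; hence `u = h + w` with `h` `κ`-harmonic on `Q_r(z)` — the comparison step of the Campanato road
# ([Giaquinta1984] Ch. III §2) to the LOCAL η-scale Hölder estimate `Hloc` of `B9Eq343FlatWindowLetterOfLocalHolder`.

statement-level skeleton of published theorems with citation tags; proofs where landed; nothing here is a claim about the Yang–Mills mass gap

CITATION HEADER (lean-in-tree rule).  Audit cell `pub-balaban`, sub-cell `t4`, BINDER row NE9; filed by NE9 crux-team LEAF PROVER 01
(`b2b-balaban-t4-ne9-formalise-leaf-01`, gen 94; bears_on: R4/N22).  CONTENT: [folklore] finite-dimensional linear algebra (injective ⟹ bijective for the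
Dirichlet operator of a box, positivity from the energy identity of `B4Eq19LatticeOperators`) and the energy inequality by summation by parts + Cauchy–Schwarz
(continuum: [Giaquinta1984] Ch. III §2, proof of Thm 2.2, pp. 78–79).  Nothing of [Balaban1984PropagatorsII] is asserted.

WHAT IS PROVED (sorry-free; proof lane — 0 `def`).
* `lop_add`, `gradSq_add_le`, `gradSq_sub_le` (bookkeeping); `gradSq_le_of_support` (the energy of a function supported in `Q_r(z)` lives on `Q_{r+1}(z)`).
* **`exists_dirichlet`** — `κ > 0`: `∃ w`, `w = 0` off `Q_r(z)`, `(−Δ+κ)w = ψ` on `Q_r(z)`.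
* **`dirichlet_energy_le`** — `κ ≥ 0`, `w = 0` off `Q_r(z)`, `(−Δ+κ)w = ∂*g` on `Q_r(z)` ⟹ `gradSq w (Q_{r+1}(z)) ≤ Σ_{y ∈ Q_{r+1}(z)} Σ_μ g(y,μ)²`.
* **`exists_harmonic_replacement`** — `κ > 0`, `(−Δ+κ)u = ∂*g` on `Q_r(z)` ⟹ `u = h + w`, `h` `κ`-harmonic on `Q_r(z)`, `w = 0` off `Q_r(z)`,
  `gradSq w Q ≤ Σ_{Q_{r+1}(z)} |g|²` for every finset `Q`.
HONEST SCOPE.  [folklore] lattice analysis on `ℤ^d`; one step of the road to `Hloc`; NOT summit progress (cell pub-balaban: NE9 NOT PRINTED ∕ NOT PROVED;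
spine PROVED 0∕9; finite T⁴ — NOT infinite volume, NOT mass gap, NOT BetaPertH, NOT Clay).  NEW file importing `B4Eq19LatticeOperators` only.
Net new unproved facts: 0.
-/

noncomputable section

open scoped BigOperators
open Finset

namespace Literature.MathematicalPhysics.QuantumFieldTheory.Balaban1983to89.B4Eq19LatticeDirichletReplacement

open B4Eq19LatticeOperators

variable {d : ℕ}

/-! ## §1 Bookkeeping -/

/-- `lop` is additive. [folklore] [cite: Balaban1984PropagatorsII, (1.3) p.225] -/
theorem lop_add (κ : ℝ) (u v : Zd d → ℝ) (y : Zd d) : lop κ (fun x => u x + v x) y = lop κ u y + lop κ v y := by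
  have h : ∀ μ : Fin d, 2 * (u y + v y) - (u (y + unitVec μ) + v (y + unitVec μ)) - (u (y - unitVec μ) + v (y - unitVec μ)) =
      (2 * u y - u (y + unitVec μ) - u (y - unitVec μ)) + (2 * v y - v (y + unitVec μ) - v (y - unitVec μ)) := fun μ => by ring
  simp only [lop, h, Finset.sum_add_distrib]; ring

/-- `lop κ 0 = 0`. [folklore] [cite: Balaban1984PropagatorsII, (1.3) p.225] -/
theorem lop_zero (κ : ℝ) (y : Zd d) : lop κ (fun _ => (0 : ℝ)) y = 0 := by
  simp [lop]

/-- `gradSq (h + w) ≤ 2·gradSq h + 2·gradSq w`. [folklore] [cite: Giaquinta1984, Ch. III §2 p.78] -/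
theorem gradSq_add_le (h w : Zd d → ℝ) (Q : Finset (Zd d)) :
    gradSq (fun y => h y + w y) Q ≤ 2 * gradSq h Q + 2 * gradSq w Q := by
  simp only [gradSq_def, Finset.mul_sum, ← Finset.sum_add_distrib]
  refine Finset.sum_le_sum fun y _ => Finset.sum_le_sum fun μ _ => ?_
  rw [fdiff_add]
  nlinarith [sq_nonneg (fdiff μ h y - fdiff μ w y)]

/-- `gradSq (u − w) ≤ 2·gradSq u + 2·gradSq w`. [folklore] [cite: Giaquinta1984, Ch. III §2 p.78] -/
theorem gradSq_sub_le (u w : Zd d → ℝ) (Q : Finset (Zd d)) :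
    gradSq (fun y => u y - w y) Q ≤ 2 * gradSq u Q + 2 * gradSq w Q := by
  simp only [gradSq_def, Finset.mul_sum, ← Finset.sum_add_distrib]
  refine Finset.sum_le_sum fun y _ => Finset.sum_le_sum fun μ _ => ?_
  rw [fdiff_sub]
  nlinarith [sq_nonneg (fdiff μ u y + fdiff μ w y)]

/-- The forward differences of a function vanishing off `Q_r(z)` vanish off `Q_{r+1}(z)`. [folklore] [cite: Giaquinta1984, Ch. III §2 p.78] -/
theorem fdiff_eq_zero_of_support {w : Zd d → ℝ} {z : Zd d} {r : ℤ} (hw0 : ∀ y ∉ box z r, w y = 0) {y : Zd d}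
    (hy : y ∉ box z (r + 1)) (μ : Fin d) : fdiff μ w y = 0 := by
  rw [fdiff, hw0 y fun h => hy (box_mono z (by linarith) h), hw0 _ (add_unitVec_not_mem_box hy μ), sub_zero]

/-- **The energy of a function supported in `Q_r(z)` lives on `Q_{r+1}(z)`**: `gradSq w Q ≤ gradSq w (Q_{r+1}(z))` for every finset `Q`.
[folklore] [cite: Giaquinta1984, Ch. III §2 p.78] -/
theorem gradSq_le_of_support {w : Zd d → ℝ} {z : Zd d} {r : ℤ} (hw0 : ∀ y ∉ box z r, w y = 0) (Q : Finset (Zd d)) :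
    gradSq w Q ≤ gradSq w (box z (r + 1)) := by
  classical
  rw [gradSq_def, gradSq_def]
  have h1 : ∑ y ∈ Q ∩ box z (r + 1), ∑ μ, fdiff μ w y ^ 2 = ∑ y ∈ Q, ∑ μ, fdiff μ w y ^ 2 := by
    apply Finset.sum_subset Finset.inter_subset_left
    intro y hyQ hy
    have hy' : y ∉ box z (r + 1) := fun h => hy (Finset.mem_inter.2 ⟨hyQ, h⟩)
    exact Finset.sum_eq_zero fun μ _ => by rw [fdiff_eq_zero_of_support hw0 hy' μ]; ring
  rw [← h1]
  exact Finset.sum_le_sum_of_subset_of_nonneg Finset.inter_subset_right fun _ _ _ => Finset.sum_nonneg fun _ _ => sq_nonneg _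

/-! ## §2 The Dirichlet problem on a box (`κ > 0`) -/

/-- **THE DIRICHLET PROBLEM ON A BOX**: for `κ > 0`, every `ψ` has a `w : ℤ^d → ℝ` with `w = 0` off `Q_r(z)` and `(−Δ+κ)w = ψ` on `Q_r(z)` (the linear map
`v ↦ ((−Δ+κ)(ext v))|_{Q_r(z)}` on functions on the finite set `Q_r(z)` is injective by the energy identity — `κΣv² ≤ Σ v·(−Δ+κ)v = 0` — hence bijective).
[folklore] [cite: Giaquinta1984, Ch. III §2 p.78] -/
theorem exists_dirichlet {κ : ℝ} (hκ : 0 < κ) (z : Zd d) (r : ℤ) (ψ : Zd d → ℝ) :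
    ∃ w : Zd d → ℝ, (∀ y ∉ box z r, w y = 0) ∧ (∀ y ∈ box z r, lop κ w y = ψ y) := by
  classical
  set S : Finset (Zd d) := box z r with hS
  -- extension by zero, as a linear map
  let ext : (S → ℝ) →ₗ[ℝ] (Zd d → ℝ) :=
    { toFun := fun v y => if h : y ∈ S then v ⟨y, h⟩ else 0
      map_add' := fun v v' => by
        funext y; by_cases h : y ∈ S <;> simp [h]
      map_smul' := fun c v => by
        funext y; by_cases h : y ∈ S <;> simp [h] }
  have ext_apply_mem : ∀ (v : S → ℝ) (y : Zd d) (h : y ∈ S), ext v y = v ⟨y, h⟩ := fun v y h => by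
    simp [ext, h]
  have ext_apply_not_mem : ∀ (v : S → ℝ) (y : Zd d), y ∉ S → ext v y = 0 := fun v y h => by
    simp [ext, h]
  -- the Dirichlet operator
  let T : (S → ℝ) →ₗ[ℝ] (S → ℝ) :=
    { toFun := fun v x => lop κ (ext v) x
      map_add' := fun v v' => by
        funext x
        have : ext (v + v') = fun y => ext v y + ext v' y := by rw [map_add]; rfl
        rw [this, lop_add]; rfl
      map_smul' := fun c v => by
        funext x
        have : ext (c • v) = fun y => c * ext v y := by rw [map_smul]; rfl
        rw [this, lop_const_mul]; rfl }
  have T_apply : ∀ (v : S → ℝ) (x : S), T v x = lop κ (ext v) x := fun v x => rfl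
  -- injectivity from the energy identity
  have hinj : Function.Injective T := by
    rw [← LinearMap.ker_eq_bot, LinearMap.ker_eq_bot']
    intro v hv
    have hsupp : ∀ y ∉ box z (r + 1 - 1), ext v y = 0 := fun y hy => ext_apply_not_mem v y (by rwa [show r + 1 - 1 = r by ring] at hy)
    have hE := sum_mul_lop_self κ (ext v) z (r + 1) hsupp
    have hzero : ∑ y ∈ box z (r + 1), ext v y * lop κ (ext v) y = 0 := by
      refine Finset.sum_eq_zero fun y _ => ?_
      by_cases hy : y ∈ S
      · have : lop κ (ext v) y = T v ⟨y, hy⟩ := rfl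
        rw [this, hv]; simp
      · rw [ext_apply_not_mem v y hy, zero_mul]
    have hsq : ∑ y ∈ box z (r + 1), ext v y ^ 2 = 0 := by
      have h1 : 0 ≤ ∑ y ∈ box z (r + 1), ext v y ^ 2 := Finset.sum_nonneg fun _ _ => sq_nonneg _
      have h2 : κ * ∑ y ∈ box z (r + 1), ext v y ^ 2 ≤ 0 := by linarith [gradSq_nonneg (ext v) (box z (r + 1))]
      nlinarith
    have hall : ∀ y ∈ box z (r + 1), ext v y = 0 := by
      intro y hy
      have := (Finset.sum_eq_zero_iff_of_nonneg fun _ _ => sq_nonneg _).1 hsq y hy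
      exact pow_eq_zero_iff (n := 2) (by norm_num) |>.1 this
    funext x
    have hx : (x : Zd d) ∈ box z (r + 1) := box_mono z (by linarith) x.2
    have := hall x hx
    rw [ext_apply_mem v x x.2] at this
    simpa using this
  have hsurj : Function.Surjective T := LinearMap.surjective_of_injective hinj
  obtain ⟨v, hv⟩ := hsurj fun x => ψ x
  refine ⟨ext v, fun y hy => ext_apply_not_mem v y (by simpa [hS] using hy), fun y hy => ?_⟩
  have : T v ⟨y, by simpa [hS] using hy⟩ = ψ y := by rw [hv]
  rw [T_apply] at this
  exact this

/-! ## §3 The energy bound of the replacement -/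

/-- Cauchy–Schwarz for a double sum over sites and directions. [folklore] [cite: Giaquinta1984, Ch. III §2 p.78] -/
theorem sum_sum_mul_le_sqrt_mul_sqrt (Q : Finset (Zd d)) (a b : Zd d → Fin d → ℝ) :
    ∑ y ∈ Q, ∑ μ, a y μ * b y μ ≤ Real.sqrt (∑ y ∈ Q, ∑ μ, a y μ ^ 2) * Real.sqrt (∑ y ∈ Q, ∑ μ, b y μ ^ 2) := by
  classical
  have h := Real.sum_mul_le_sqrt_mul_sqrt (Q ×ˢ (Finset.univ : Finset (Fin d))) (fun p => a p.1 p.2) (fun p => b p.1 p.2)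
  simpa only [Finset.sum_product] using h

/-- **THE ENERGY BOUND**: for `κ ≥ 0`, if `w = 0` off `Q_r(z)` and `(−Δ+κ)w = ∂*g` on `Q_r(z)`, then
`gradSq w (Q_{r+1}(z)) ≤ Σ_{y ∈ Q_{r+1}(z)} Σ_μ g(y,μ)²` (`Σ|∇w|² + κΣw² = Σ w·∂*g = Σ ∇w·g ≤ ‖∇w‖‖g‖`).
[folklore] [cite: Giaquinta1984, Ch. III §2 (2.8) p.79] -/
theorem dirichlet_energy_le {κ : ℝ} (hκ : 0 ≤ κ) {w : Zd d → ℝ} {z : Zd d} {r : ℤ} (g : Zd d → Fin d → ℝ)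
    (hw0 : ∀ y ∉ box z r, w y = 0) (hw : ∀ y ∈ box z r, lop κ w y = dvg g y) :
    gradSq w (box z (r + 1)) ≤ ∑ y ∈ box z (r + 1), ∑ μ, g y μ ^ 2 := by
  classical
  have hsupp : ∀ y ∉ box z (r + 1 - 1), w y = 0 := fun y hy => hw0 y (by simpa using hy)
  have hE := sum_mul_lop_self κ w z (r + 1) hsupp
  have hD := sum_mul_dvg w g z (r + 1) hsupp
  have hEq' : ∑ y ∈ box z (r + 1), w y * lop κ w y = ∑ y ∈ box z (r + 1), w y * dvg g y := by
    refine Finset.sum_congr rfl fun y _ => ?_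
    by_cases hy : y ∈ box z r
    · rw [hw y hy]
    · rw [hw0 y hy, zero_mul, zero_mul]
  set E := gradSq w (box z (r + 1)) with hEdef
  set G := ∑ y ∈ box z (r + 1), ∑ μ, g y μ ^ 2 with hGdef
  have hE0 : 0 ≤ E := gradSq_nonneg _ _
  have hG0 : 0 ≤ G := Finset.sum_nonneg fun _ _ => Finset.sum_nonneg fun _ _ => sq_nonneg _
  have hmass : 0 ≤ κ * ∑ y ∈ box z (r + 1), w y ^ 2 := mul_nonneg hκ (Finset.sum_nonneg fun _ _ => sq_nonneg _)
  have hCS : ∑ y ∈ box z (r + 1), ∑ μ, fdiff μ w y * g y μ ≤ Real.sqrt E * Real.sqrt G := by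
    have := sum_sum_mul_le_sqrt_mul_sqrt (box z (r + 1)) (fun y μ => fdiff μ w y) g
    rw [hEdef, gradSq_def]
    exact this
  have h1 : E ≤ Real.sqrt E * Real.sqrt G := by
    have : E + κ * ∑ y ∈ box z (r + 1), w y ^ 2 = ∑ y ∈ box z (r + 1), ∑ μ, fdiff μ w y * g y μ := by
      rw [← hE, hEq', hD]
    linarith
  -- `E ≤ √E √G` ⟹ `E ≤ G`
  have h2 : Real.sqrt E * Real.sqrt E ≤ Real.sqrt E * Real.sqrt G := by rwa [Real.mul_self_sqrt hE0]
  by_cases hE' : Real.sqrt E = 0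
  · have : E = 0 := by rwa [Real.sqrt_eq_zero hE0] at hE'
    rw [this]; exact hG0
  · have hpos : 0 < Real.sqrt E := lt_of_le_of_ne (Real.sqrt_nonneg _) (Ne.symm hE')
    have h3 : Real.sqrt E ≤ Real.sqrt G := le_of_mul_le_mul_left h2 hpos
    rw [Real.sqrt_le_sqrt_iff hG0] at h3
    exact h3

/-! ## §4 The harmonic replacement packaged -/

/-- **HARMONIC REPLACEMENT ON A BOX.**  For `κ > 0` and `(−Δ+κ)u = ∂*g` on `Q_r(z)` there are `h`, `w` with `u = h + w` everywhere, `w = 0` off `Q_r(z)`,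
`h` `κ`-harmonic on `Q_r(z)`, and `gradSq w Q ≤ Σ_{y ∈ Q_{r+1}(z)} Σ_μ g(y,μ)²` for EVERY finset `Q`.
[folklore] [cite: Giaquinta1984, Ch. III §2 pp.78–79; Balaban1984PropagatorsII, (1.9) p.226] -/
theorem exists_harmonic_replacement {κ : ℝ} (hκ : 0 < κ) (u : Zd d → ℝ) (g : Zd d → Fin d → ℝ) (z : Zd d) (r : ℤ)
    (hEq : ∀ y ∈ box z r, lop κ u y = dvg g y) :
    ∃ h w : Zd d → ℝ, (∀ y, u y = h y + w y) ∧ (∀ y ∉ box z r, w y = 0) ∧ (∀ y ∈ box z r, lop κ h y = 0) ∧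
      (∀ Q : Finset (Zd d), gradSq w Q ≤ ∑ y ∈ box z (r + 1), ∑ μ, g y μ ^ 2) := by
  obtain ⟨w, hw0, hw⟩ := exists_dirichlet hκ z r (dvg g)
  refine ⟨fun y => u y - w y, w, fun y => by ring, hw0, fun y hy => ?_, fun Q => ?_⟩
  · rw [lop_sub, hEq y hy, hw y hy, sub_self]
  · exact (gradSq_le_of_support hw0 Q).trans (dirichlet_energy_le hκ.le g hw0 hw)

end Literature.MathematicalPhysics.QuantumFieldTheory.Balaban1983to89.B4Eq19LatticeDirichletReplacement

end
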